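import Literature.AnabelianGeometry.SemiGraphs.ProSigmaCompletionSlim
import Mathlib.GroupTheory.SemidirectProduct
import HarnessLib

/-!
# Pro-`Σ` completions of free groups: the permutation-module obstruction at one finite level
# (towards: non-trivial NORMAL subgroups of free pro-`Σ` groups have trivial centraliser)

[AbsAnab] (S. Mochizuki, *The absolute anabelian geometry of hyperbolic curves*, 2004), Lemma 1.3.1 p. 15
("`Δ_X`, `Π_X` are slim") [cite: MochizukiAbsAnab2004, Lemma 1.3.1 p.15]; [AbsTopI] (*Topics in Absolute
Anabelian Geometry I*, 2012) Thm 2.6 (iv)/(v) p. 22, whose «`Δ ⊆ Π` characteristic» route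
(`AbsTopIThm26GeomCentralizerRoute.lean`, abc-iut-w6-d055) isolates the classical input
«(H′): a non-trivial normal subgroup of a free profinite group of finite rank `≥ 2` has trivial centraliser»
(Ribes–Zalesskii, *Profinite Groups*, §8.6–8.7).  Cell `abc-iut`, seat abc-iut-w4-d044 (gen 7), row
«HPRIME-PROVED» (abc-iut-L6-lead §F v1.19cc): (H′) PROVED as a kernel theorem by an elementary route — this
file is the ONE-LEVEL step; the theorem itself is assembled in `ProSigmaCompletionNormalCentralizer.lean`.

PROOF-ONLY (no definition, no instance, no named fact), over abc-iut-L3-t1's interface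
`IsProSigmaCompletion Sigma ι` and the machinery of `ProSigmaCompletionExtend.lean` /
`ProSigmaCompletionSlim.lean` (abc-iut-L5-t9), consumed BY NAME.

WHAT IS SHOWN (`ι : Γ → P` a pro-`Σ` completion of a FREE group, `P` profinite, `Σ` unbounded):
* `semidirect_conj_inl`, `semidirect_eq_inl_of_right_eq_one` — bookkeeping in `V ⋊ Q`, `V` commutative;
* `mulAutArrow_mulSingle` — for the arrow action on `X → M`, `g · δ_x = δ_{g·x}`;
  `mulSingle_mass_eq_one_or_sq_eq_one` — evaluating `δ_{x₁} δ_{x₂}⁻¹ = δ_{x₃} δ_{x₀}⁻¹` at `x₀ ∉ {x₂, x₃}`;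
* **`mk_mem_zpowers_or_of_mem_centralizer`** (Step A) — for a free generator `a`, `s = ι(a)`, `N ⊴ P`,
  `W ⊴ P` open, `z ∈ Z_P(N)`, `y ∈ N`: modulo `W`, `z̄ ∈ ⟨s̄⟩` or `ȳ ∈ ⟨s̄⟩`.  Route: in `Q = P/W` let
  `S = ⟨s̄⟩`, `X = Q/S`, `V = (X → μ_p)` with `p ∈ Σ` prime, `p > |Q|`, `p > 2`, and the finite `Σ`-group
  `K = V ⋊ Q`; the assignment `a ↦ (δ_S, s̄)`, `b ↦ (1, b̄)` extends continuously to `F : P → K` lying over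
  `P → Q` (density + uniqueness into the discrete `Q`); on `W` the `V`-component of `F` is a `Q`-equivariant
  homomorphism with `F(s^{ord s̄}) = δ_S^{ord s̄}`; `z` centralises the commutator `[y, s^{ord s̄}] ∈ N ∩ W`, so
  `z̄ · (ȳ·δ_S^m · δ_S^{-m}) = ȳ·δ_S^m · δ_S^{-m}`, and evaluation at the coset `S` (if `ȳ S ≠ S ≠ z̄ S`) gives
  `m ≡ 0` or `2m ≡ 0 (mod p)`, impossible for `0 < m ≤ |Q| < p`, `p` odd.

HONEST FRAMING: classical (pro)finite group theory over the cell's typed interface; refereed, undisputed;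
nothing here bears on [IUTchIII] Cor. 3.12 or takes a side; typed ≠ proved elsewhere; nothing asserts abc
proved or refuted.
-/

namespace Literature.AnabelianGeometry.SemiGraphs.SemiGraphOfAnabelioids.IsProSigmaCompletion

open Literature.AnabelianGeometry.Anabelioids Literature.AlgebraicGeometry.Frobenioids Topology
open Multiplicative

/-! ### Semidirect-product bookkeeping (commutative kernel) -/

section Semidirect

variable {V G : Type*} [CommGroup V] [Group G] {φ : G →* MulAut V}

/-- In `V ⋊ G` with `V` commutative, conjugating `inl v` by any element `k` gives `inl (φ k.right v)`.
[folklore] -/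
private theorem semidirect_conj_inl (k : V ⋊[φ] G) (v : V) :
    k * SemidirectProduct.inl v * k⁻¹ = SemidirectProduct.inl (φ k.right v) := by
  ext
  · simp only [SemidirectProduct.mul_left, SemidirectProduct.left_inl, SemidirectProduct.inv_left,
      SemidirectProduct.mul_right, SemidirectProduct.right_inl, mul_one, map_inv,
      MulAut.apply_inv_self]
    rw [mul_comm k.left, mul_assoc, mul_inv_cancel, mul_one]
  · simp only [SemidirectProduct.mul_right, SemidirectProduct.right_inl, SemidirectProduct.inv_right,
      mul_one, mul_inv_cancel]

/-- An element of `V ⋊ G` with trivial `G`-component is `inl` of its `V`-component. [folklore] -/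
private theorem semidirect_eq_inl_of_right_eq_one (k : V ⋊[φ] G) (hk : k.right = 1) :
    k = SemidirectProduct.inl k.left := by
  rw [← SemidirectProduct.inl_left_mul_inr_right k, hk, map_one, mul_one, SemidirectProduct.left_inl]

end Semidirect

/-! ### The permutation module `(Q/S → μ_p)`: translates of a point mass -/

section PointMass

variable {Q : Type*} [Group Q] {X : Type*} [MulAction Q X] {M : Type*} [Monoid M]

/-- `g · δ_x = δ_{g x}` for the arrow action `(g · F)(a) = F(g⁻¹ a)`. [folklore] -/
private theorem mulAutArrow_mulSingle [DecidableEq X] (g : Q) (x : X) (c : M) :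
    mulAutArrow (A := X) (M := M) g (Pi.mulSingle x c) = Pi.mulSingle (g • x) c := by
  funext a
  change (Pi.mulSingle x c : X → M) (g⁻¹ • a) = (Pi.mulSingle (g • x) c : X → M) a
  rw [Pi.mulSingle_apply, Pi.mulSingle_apply]
  simp only [inv_smul_eq_iff]

/-- Evaluation of `δ_{x₁} δ_{x₂}⁻¹ = δ_{x₃} δ_{x₀}⁻¹` at `x₀ ∉ {x₂, x₃}`: the mass `c` satisfies `c = 1` or
`c² = 1`. [folklore] -/
private theorem mulSingle_mass_eq_one_or_sq_eq_one [DecidableEq X] {C : Type*} [Group C] {x₀ x₁ x₂ x₃ : X} {c : C}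
    (h : (Pi.mulSingle x₁ c : X → C) * (Pi.mulSingle x₂ c)⁻¹ = Pi.mulSingle x₃ c * (Pi.mulSingle x₀ c)⁻¹)
    (h2 : x₀ ≠ x₂) (h3 : x₀ ≠ x₃) : c = 1 ∨ c * c = 1 := by
  have key := congrFun h x₀
  simp only [Pi.mul_apply, Pi.inv_apply, Pi.mulSingle_apply, if_neg h2, if_neg h3,
    inv_one, mul_one, one_mul] at key
  by_cases h1 : x₀ = x₁
  · rw [if_pos h1, eq_inv_iff_mul_eq_one] at key
    exact Or.inr key
  · rw [if_neg h1, eq_comm, inv_eq_one] at key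
    exact Or.inl key

end PointMass

variable {Sigma : Set ℕ} {Γ : Type*} [Group Γ] {P : Type*} [Group P] [TopologicalSpace P]
  {ι : Γ →* P}

section Profinite

variable [IsTopologicalGroup P] [CompactSpace P] [TotallyDisconnectedSpace P]

/-! ### Step A: the permutation-module obstruction at one finite level -/

/-- **Obstruction (one generator, one level).**  Let `ι : Γ → P` be a pro-`Σ` completion of a free
group (`P` profinite) with `Σ` unbounded, `a` a free generator, `s = ι(a)`, `N ⊴ P` normal, `W ⊴ P` open
normal, `z ∈ Z_P(N)` and `y ∈ N`.  Then modulo `W` one of `z`, `y` is a power of `s`.  (In `Q = P/W` put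
`S = ⟨s̄⟩` and let `Q` act on `V = (Q/S → μ_p)`, `p ∈ Σ` a prime `> |Q|`, `> 2`; the assignment
`a ↦ (δ_S, s̄)`, `b ↦ (0, b̄)` (`b ≠ a`) extends continuously to `F : P → V ⋊ Q` over `P → Q`; its
restriction to `W` is a `Q`-equivariant homomorphism `π : W → V` with `π(s^{ord s̄}) = ord(s̄)·δ_S`; `z`
centralises `[y, s^{ord s̄}] ∈ N ∩ W`, whence `z̄ · (ȳ − 1) · δ_S = (ȳ − 1) · δ_S` in `V` after cancelling the
unit `ord(s̄)`; evaluating at the coset `S` forces `ȳ ∈ S` or `z̄ ∈ S`.)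
[cite: MochizukiAbsAnab2004, Lemma 1.3.1 p.15] -/
theorem mk_mem_zpowers_or_of_mem_centralizer [IsFreeGroup Γ] (hι : IsProSigmaCompletion Sigma ι)
    (hSig : ∀ m : ℕ, ∃ p ∈ Sigma, p.Prime ∧ m < p)
    (N : Subgroup P) [N.Normal] (W : Subgroup P) [W.Normal] (hW : IsOpen (W : Set P))
    (a : IsFreeGroup.Generators Γ) {z y : P} (hz : z ∈ Subgroup.centralizer (N : Set P)) (hy : y ∈ N) :
    (QuotientGroup.mk z : P ⧸ W) ∈ Subgroup.zpowers (QuotientGroup.mk (ι (IsFreeGroup.of a))) ∨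
      (QuotientGroup.mk y : P ⧸ W) ∈ Subgroup.zpowers (QuotientGroup.mk (ι (IsFreeGroup.of a))) := by
  classical
  set s : P := ι (IsFreeGroup.of a) with hsdef
  haveI : Finite (P ⧸ W) := Subgroup.quotient_finite_of_isOpen W hW
  haveI : DiscreteTopology (P ⧸ W) := QuotientGroup.discreteTopology hW
  let π : P →* P ⧸ W := QuotientGroup.mk' W
  have hπc : Continuous π := QuotientGroup.continuous_mk
  change π z ∈ Subgroup.zpowers (π s) ∨ π y ∈ Subgroup.zpowers (π s)
  set S : Subgroup (P ⧸ W) := Subgroup.zpowers (π s) with hSdef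
  -- a prime `p ∈ Σ`, `p > |Q|`, `p > 2`
  obtain ⟨p, hpS, hpp, hpgt⟩ := hSig (max (Nat.card (P ⧸ W)) 2)
  haveI hp : Fact p.Prime := ⟨hpp⟩
  have hpQ : Nat.card (P ⧸ W) < p := lt_of_le_of_lt (le_max_left _ _) hpgt
  have hp2 : 2 < p := lt_of_le_of_lt (le_max_right _ _) hpgt
  -- the permutation module and the finite `Σ`-group `K = V ⋊ Q`
  let X := (P ⧸ W) ⧸ S
  haveI : Fintype X := Fintype.ofFinite X
  let V := X → Multiplicative (ZMod p)
  let φ : (P ⧸ W) →* MulAut V := mulAutArrow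
  let K := V ⋊[φ] (P ⧸ W)
  letI : TopologicalSpace K := ⊥
  haveI : DiscreteTopology K := ⟨rfl⟩
  haveI : Finite K := Finite.of_equiv _ SemidirectProduct.equivProd.symm
  have hcardK : IsSigmaInteger Sigma (Nat.card K) := by
    haveI : Nonempty K := ⟨1⟩
    refine ⟨Nat.card_pos, fun q hq hdvd => ?_⟩
    rw [Nat.card_congr SemidirectProduct.equivProd, Nat.card_prod] at hdvd
    rcases (Nat.Prime.dvd_mul hq).mp hdvd with h | h
    · -- `q ∣ |V| = p ^ |X|`
      have hV : Nat.card V = p ^ Fintype.card X := by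
        rw [Nat.card_pi, Finset.prod_const, Finset.card_univ]
        congr 1
        exact Nat.card_zmod p
      rw [hV] at h
      rwa [(Nat.prime_dvd_prime_iff_eq hq hpp).mp (hq.dvd_of_dvd_pow h)]
    · -- `q ∣ |Q|`, a `Σ`-integer
      have hQ : IsSigmaInteger Sigma (Nat.card (P ⧸ W)) := by
        rw [← Subgroup.index_eq_card]; exact isSigmaInteger_index hι W hW
      exact hQ.2 q hq h
  -- the point mass at the coset `S` and the generator assignment
  let x₀ : X := ((1 : P ⧸ W) : X)
  let δ : V := Pi.mulSingle x₀ (ofAdd (1 : ZMod p))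
  let f₀ : Γ →* K := IsFreeGroup.lift fun b =>
    SemidirectProduct.inl (if b = a then δ else 1) * SemidirectProduct.inr (π (ι (IsFreeGroup.of b)))
  have hf₀ : ∀ b, f₀ (IsFreeGroup.of b) =
      SemidirectProduct.inl (if b = a then δ else 1) * SemidirectProduct.inr (π (ι (IsFreeGroup.of b))) :=
    fun b => by simp [f₀]
  obtain ⟨F, hFc, hF⟩ := exists_continuous_extend_top hι hcardK f₀
  -- `F` lies over `π : P → Q`
  have hright : ∀ x : P, (F x).right = π x := by
    have hrc : Continuous (SemidirectProduct.rightHom : K → P ⧸ W) := continuous_of_discreteTopology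
    have h1 : (SemidirectProduct.rightHom.comp F : P → P ⧸ W) = π := by
      have hγ : SemidirectProduct.rightHom.comp f₀ = π.comp ι :=
        IsFreeGroup.ext_hom fun b => by
          rw [MonoidHom.comp_apply, MonoidHom.comp_apply, hf₀, map_mul, SemidirectProduct.rightHom_inl,
            SemidirectProduct.rightHom_inr, one_mul]
      refine Continuous.ext_on hι.dense (hrc.comp hFc) hπc ?_
      intro x hx
      obtain ⟨γ, rfl⟩ := hx
      change SemidirectProduct.rightHom (F (ι γ)) = π (ι γ)
      rw [hF, ← MonoidHom.comp_apply, hγ, MonoidHom.comp_apply]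
    intro x
    have := congrFun h1 x
    rwa [MonoidHom.coe_comp, Function.comp_apply, SemidirectProduct.rightHom_eq_right] at this
  have hFW : ∀ w ∈ W, F w = SemidirectProduct.inl (F w).left := fun w hw =>
    semidirect_eq_inl_of_right_eq_one _ (by rw [hright]; exact (QuotientGroup.eq_one_iff w).mpr hw)
  -- `left ∘ F` is multiplicative on `W` …
  have hmulW : ∀ w ∈ W, ∀ w' ∈ W, (F (w * w')).left = (F w).left * (F w').left := by
    intro w hw w' hw'
    obtain ⟨v, hv⟩ : ∃ v, F w = SemidirectProduct.inl v := ⟨_, hFW w hw⟩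
    obtain ⟨v', hv'⟩ : ∃ v', F w' = SemidirectProduct.inl v' := ⟨_, hFW w' hw'⟩
    rw [map_mul, hv, hv', ← map_mul, SemidirectProduct.left_inl, SemidirectProduct.left_inl,
      SemidirectProduct.left_inl]
  have hinvW : ∀ w ∈ W, (F w⁻¹).left = ((F w).left)⁻¹ := by
    intro w hw
    obtain ⟨v, hv⟩ : ∃ v, F w = SemidirectProduct.inl v := ⟨_, hFW w hw⟩
    rw [map_inv, hv, ← map_inv, SemidirectProduct.left_inl, SemidirectProduct.left_inl]
  -- … and `Q`-equivariant under conjugation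
  have hconjW : ∀ (g : P), ∀ w ∈ W, (F (g * w * g⁻¹)).left = φ (π g) (F w).left := by
    intro g w hw
    obtain ⟨v, hv⟩ : ∃ v, F w = SemidirectProduct.inl v := ⟨_, hFW w hw⟩
    rw [map_mul, map_mul, map_inv, hv, semidirect_conj_inl, SemidirectProduct.left_inl,
      SemidirectProduct.left_inl, hright]
  -- the element `u = s ^ ord(s̄) ∈ W` and its image `δ ^ m`
  set m : ℕ := orderOf (π s) with hmdef
  have hm0 : 0 < m := orderOf_pos (π s)
  have hmQ : m ≤ Nat.card (P ⧸ W) := Nat.le_of_dvd Nat.card_pos (orderOf_dvd_natCard (π s))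
  have huW : s ^ m ∈ W :=
    (QuotientGroup.eq_one_iff _).mp (by rw [QuotientGroup.mk_pow]; exact pow_orderOf_eq_one (π s))
  have hmemS : ∀ g : P ⧸ W, g • x₀ = x₀ ↔ g ∈ S := fun g => by
    change g • ((1 : P ⧸ W) : X) = ((1 : P ⧸ W) : X) ↔ _
    rw [MulAction.Quotient.smul_mk, smul_eq_mul, mul_one, QuotientGroup.eq, mul_one, inv_mem_iff]
  have hφs : ∀ (g : P ⧸ W) (x : X) (c : Multiplicative (ZMod p)),
      φ g (Pi.mulSingle x c) = Pi.mulSingle (g • x) c := fun g x c => mulAutArrow_mulSingle g x c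
  have hφδ : φ (π s) δ = δ := by
    change φ (π s) (Pi.mulSingle x₀ (ofAdd (1 : ZMod p))) = Pi.mulSingle x₀ (ofAdd (1 : ZMod p))
    rw [hφs, (hmemS (π s)).mpr (Subgroup.mem_zpowers _)]
  have hFu : (F (s ^ m)).left = δ ^ m := by
    have hcomm : Commute (SemidirectProduct.inl δ : K) (SemidirectProduct.inr (π s)) := by
      have h := SemidirectProduct.inl_aut (φ := φ) (π s) δ
      rw [hφδ] at h
      change SemidirectProduct.inl δ * SemidirectProduct.inr (π s) =
        SemidirectProduct.inr (π s) * SemidirectProduct.inl δ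
      calc SemidirectProduct.inl δ * SemidirectProduct.inr (π s)
          = SemidirectProduct.inr (π s) * SemidirectProduct.inl δ * SemidirectProduct.inr (π s)⁻¹ *
              SemidirectProduct.inr (π s) := by rw [← h]
        _ = SemidirectProduct.inr (π s) * SemidirectProduct.inl δ := by
              rw [map_inv, inv_mul_cancel_right]
    have hFs : F s = SemidirectProduct.inl δ * SemidirectProduct.inr (π s) := by
      rw [hsdef, hF, hf₀, if_pos rfl]
    rw [map_pow, hFs, hcomm.mul_pow, ← map_pow, ← map_pow, pow_orderOf_eq_one, map_one, mul_one,
      SemidirectProduct.left_inl]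
  -- the commutator `c = y u y⁻¹ u⁻¹ ∈ N ∩ W` is centralised by `z`
  set u : P := s ^ m with hudef
  have hcN : y * u * y⁻¹ * u⁻¹ ∈ N := by
    have h : u * y⁻¹ * u⁻¹ ∈ N := Subgroup.Normal.conj_mem inferInstance _ (N.inv_mem hy) u
    have := N.mul_mem hy h
    simpa only [mul_assoc] using this
  have hyuy : y * u * y⁻¹ ∈ W := Subgroup.Normal.conj_mem inferInstance _ huW y
  have hcW : y * u * y⁻¹ * u⁻¹ ∈ W := W.mul_mem hyuy (W.inv_mem huW)
  have hzc : z * (y * u * y⁻¹ * u⁻¹) * z⁻¹ = y * u * y⁻¹ * u⁻¹ := by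
    have h := (Subgroup.mem_centralizer_iff.mp hz) _ hcN
    rw [← h, mul_inv_cancel_right]
  -- the vector identity `φ(z̄) v = v`, `v = φ(ȳ)(δ^m) · (δ^m)⁻¹`
  have hv : (F (y * u * y⁻¹ * u⁻¹)).left = φ (π y) (δ ^ m) * (δ ^ m)⁻¹ := by
    rw [hmulW _ hyuy _ (W.inv_mem huW), hconjW y u huW, hinvW u huW, hFu]
  have hfix : φ (π z) (φ (π y) (δ ^ m) * (δ ^ m)⁻¹) = φ (π y) (δ ^ m) * (δ ^ m)⁻¹ := by
    rw [← hv, ← hconjW z _ hcW, hzc]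
  have hδm : δ ^ m = Pi.mulSingle x₀ (ofAdd (m : ZMod p)) := by
    change (Pi.mulSingle x₀ (ofAdd (1 : ZMod p)) : V) ^ m = _
    rw [← Pi.mulSingle_pow, ← ofAdd_nsmul, nsmul_eq_mul, mul_one]
  rw [hδm, map_mul, map_inv, hφs, hφs, hφs] at hfix
  -- evaluate at the coset `S`
  by_contra hcon
  rw [not_or] at hcon
  obtain ⟨hzS, hyS⟩ := hcon
  have hzx : x₀ ≠ π z • x₀ := fun h => hzS ((hmemS _).mp h.symm)
  have hyx : x₀ ≠ π y • x₀ := fun h => hyS ((hmemS _).mp h.symm)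
  have hpm : ¬ p ∣ m := fun h => absurd (Nat.le_of_dvd hm0 h) (by omega)
  rcases mulSingle_mass_eq_one_or_sq_eq_one hfix hzx hyx with hc | hc
  · -- `c = 1`: `m ≡ 0 (mod p)`
    rw [ofAdd_eq_one, ZMod.natCast_eq_zero_iff] at hc
    exact hpm hc
  · -- `c² = 1`: `2m ≡ 0 (mod p)`
    rw [← ofAdd_add, ofAdd_eq_one, ← Nat.cast_add, ZMod.natCast_eq_zero_iff, ← two_mul] at hc
    rcases (Nat.Prime.dvd_mul hpp).mp hc with h | h
    · exact absurd (Nat.le_of_dvd two_pos h) (by omega)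
    · exact hpm h

end Profinite

end Literature.AnabelianGeometry.SemiGraphs.SemiGraphOfAnabelioids.IsProSigmaCompletion
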